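import Mathlib
import HarnessLib
import Literature.MathematicalPhysics.StatisticalMechanics.StrongNormExp
import Literature.MathematicalPhysics.StatisticalMechanics.StrongWeightABKM
import Literature.MathematicalPhysics.StatisticalMechanics.RelevantHamiltonianSpace
import Literature.MathematicalPhysics.StatisticalMechanics.LinearisedMapOpB

/-!
# Lipschitz continuity of the exponential map into the strong norm ([ABKM19] Lemma 9.3, `DE` bound):
# `|e^{±H(B)} − e^{±H'(B)}|_{T_φ} ≤ 16 e^{3/8} ‖H − H'‖_{k,0} W(φ)` for `‖H‖_{k,0}, ‖H'‖_{k,0} ≤ 1/16`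

[ABKM19] Lemma 9.3 bounds the derivative `DE(H)Ḣ = e^{H}Ḣ` of `E(H) = e^{H}` uniformly on a ball, so
`E` is Lipschitz from `(M_0, ‖·‖_{k,0})` into the strong norm `|||·|||_k`.  We prove the Lipschitz
bound directly (first-order form, no derivatives in `H`): `e^{F} − e^{G} = e^{G}(e^{F−G} − 1)`, the
product property, `‖e^G‖_{T_φ} ≤ e^{‖G‖_{T_φ}}`, `‖e^{D} − 1‖_{T_φ} ≤ ‖D‖_{T_φ}e^{‖D‖_{T_φ}}` and the `ℓ²`
domination `|H(B)|_{T_φ} ≤ 2(1+N(φ)²)‖H‖_{k,0}`, `e^{N²/2} ≤ W(φ)`; the radius `1/16` (instead of `⅛`)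
leaves room for the two exponential factors.

* `eval_sub` — `(H − H')(B, φ) = H(B, φ) − H'(B, φ)`;
* **`tayNormLE_cexp_eval_sub_cexp_eval`** — abstract `ℓ²`-dominating weight;
* **`tayNormLE_cexp_neg_eval_sub`** — the Boltzmann factors `e^{−H(B)} − e^{−H'(B)}`;
* **`tayNormLE_expNegH_sub_strong_abkm`** — the instantiation for the torus tower's strong weight `W_k^B`.

Everything is proved; no named fact.

## References
* S. Adams, S. Buchholz, R. Kotecký, S. Müller, arXiv:1910.13564, Lemma 9.3 ((9.13)–(9.16))
  [AdamsBuchholzKoteckyMuller2019].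
-/

noncomputable section

namespace Literature.MathematicalPhysics.StatisticalMechanics.GradientRG

open scoped BigOperators
open Finset
open Literature.MathematicalPhysics.QuantumFieldTheory
open Literature.MathematicalPhysics.StatisticalMechanics.TorusPolymer (blockOf)

variable {𝕜 : Type*} {d M : ℕ} [NeZero M]

section Eval

variable [CommRing 𝕜] [Algebra ℝ 𝕜]

omit [NeZero M] in
/-- `(−H)(B, φ) = −H(B, φ)`. [cite: AdamsBuchholzKoteckyMuller2019, Ch. 6.2 (M_0 is a linear space)] -/
theorem eval_neg (H : RelevantHamiltonian 𝕜 d) (B : Finset (Fin d → ZMod M))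
    (φ : (Fin d → ZMod M) → ℝ) : eval (-H) B φ = -(eval H B φ) := by
  have h := eval_add H (-H) B φ
  rw [add_neg_cancel, eval_zero] at h
  exact eq_neg_of_add_eq_zero_right h.symm

omit [NeZero M] in
/-- `(H − H')(B, φ) = H(B, φ) − H'(B, φ)`. [cite: AdamsBuchholzKoteckyMuller2019, Ch. 6.2 (M_0 is a linear space)] -/
theorem eval_sub (H H' : RelevantHamiltonian 𝕜 d) (B : Finset (Fin d → ZMod M))
    (φ : (Fin d → ZMod M) → ℝ) : eval (H - H') B φ = eval H B φ - eval H' B φ := by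
  rw [sub_eq_add_neg, eval_add, eval_neg, ← sub_eq_add_neg]

end Eval

/-- `‖H − H'‖_{k,0} ≤ ‖H‖_{k,0} + ‖H'‖_{k,0}`. [cite: AdamsBuchholzKoteckyMuller2019, Ch. 6.4 (6.51)] -/
theorem hamNorm_sub_le [NormedField 𝕜] {𝔥 R : ℝ} (h𝔥 : 0 ≤ 𝔥) (hR : 0 ≤ R) (n : ℕ)
    (H H' : RelevantHamiltonian 𝕜 d) :
    hamNorm 𝔥 R n (H - H') ≤ hamNorm 𝔥 R n H + hamNorm 𝔥 R n H' := by
  rw [sub_eq_add_neg]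
  exact (hamNorm_add_le h𝔥 hR n H (-H')).trans (by rw [hamNorm_neg])

/-- `1 + N² ≤ 8 e^{N²/8}`. [folklore] -/
private theorem one_add_sq_le_eight_mul_exp (N : ℝ) : 1 + N ^ 2 ≤ 8 * Real.exp (N ^ 2 / 8) := by
  have := Real.add_one_le_exp (N ^ 2 / 8)
  nlinarith [sq_nonneg N]

/-- **Lipschitz bound of `E` into the strong norm**: for an `ℓ²`-dominating weight `W` and
`‖H‖_{k,0}, ‖H'‖_{k,0} ≤ 1/16`,
`‖e^{H(B)} − e^{H'(B)}‖_{T, W} ≤ 16 e^{3/8} ‖H − H'‖_{k,0}`.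
[cite: AdamsBuchholzKoteckyMuller2019, Lemma 9.3 (9.13)] -/
theorem tayNormLE_cexp_eval_sub_cexp_eval {𝔥 R : ℝ} (h𝔥 : 0 < 𝔥) (hR : 0 < R) {p : ℕ}
    (hp : d / 2 + 1 ≤ p) {S B : Finset (Fin d → ZMod M)} (hBS : B ⊆ S)
    {W : ((Fin d → ZMod M) → ℝ) → ℝ} (hW : Ell2Dominates B 𝔥 R W) {H H' : RelevantHamiltonian ℂ d}
    (r₀ : ℕ) (hH : hamNorm 𝔥 R B.card H ≤ 1 / 16) (hH' : hamNorm 𝔥 R B.card H' ≤ 1 / 16) :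
    TayNormLE (fieldGauge 𝔥 R p S) r₀ W
      (fun ψ : (Fin d → ZMod M) → ℝ => Complex.exp (eval H B ψ) - Complex.exp (eval H' B ψ))
      (16 * Real.exp (3 / 8) * hamNorm 𝔥 R B.card (H - H')) := by
  intro φ
  obtain ⟨N, hN0, hNlin, hNgrad, hNW⟩ := hW φ
  set T := fieldGauge 𝔥 R p S with hT
  set Δ := hamNorm 𝔥 R B.card (H - H') with hΔ
  have hΔ0 : 0 ≤ Δ := hamNorm_nonneg h𝔥.le hR.le _ _
  have hΔle : Δ ≤ 1 / 8 := (hamNorm_sub_le h𝔥.le hR.le _ H H').trans (by linarith)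
  -- the factorisation `e^F − e^G = e^G (e^{F−G} − 1)`
  have hfac : (fun ψ : (Fin d → ZMod M) → ℝ => Complex.exp (eval H B ψ) - Complex.exp (eval H' B ψ)) =
      (fun ψ => Complex.exp (eval H' B ψ)) * fun ψ => Complex.exp (eval (H - H') B ψ) - 1 := by
    funext ψ
    simp only [Pi.mul_apply, eval_sub]
    rw [mul_sub, mul_one, ← Complex.exp_add, add_sub_cancel]
  rw [hfac]
  have hGd : ContDiff ℝ r₀ (fun ψ : (Fin d → ZMod M) → ℝ => Complex.exp (eval H' B ψ)) :=
    (contDiff_eval H' B).cexp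
  have hDd : ContDiff ℝ r₀ (fun ψ : (Fin d → ZMod M) → ℝ => Complex.exp (eval (H - H') B ψ) - 1) :=
    (contDiff_eval (H - H') B).cexp.sub contDiff_const
  refine (tayNorm_mul_le T hGd hDd φ).trans ?_
  -- the two factors
  set tG := tayNorm T r₀ (fun ψ : (Fin d → ZMod M) → ℝ => eval H' B ψ) φ with htG
  set tD := tayNorm T r₀ (fun ψ : (Fin d → ZMod M) → ℝ => eval (H - H') B ψ) φ with htD
  have htG0 : 0 ≤ tG := tayNorm_nonneg _ _ _ _
  have htD0 : 0 ≤ tD := tayNorm_nonneg _ _ _ _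
  have h1 : tayNorm T r₀ (fun ψ : (Fin d → ZMod M) → ℝ => Complex.exp (eval H' B ψ)) φ ≤ Real.exp tG :=
    tayNorm_cexp_le_exp T (contDiff_eval H' B (n := r₀)) φ
  have h2 : tayNorm T r₀ (fun ψ : (Fin d → ZMod M) → ℝ => Complex.exp (eval (H - H') B ψ) - 1) φ ≤
      tD * Real.exp tD := tayNorm_cexp_sub_one_le T (contDiff_eval (H - H') B (n := r₀)) φ
  have hG1 : tG ≤ (1 + N ^ 2) * (2 * hamNorm 𝔥 R B.card H') :=
    tayNorm_eval_le_quarter (𝕜 := ℂ) h𝔥 hR hp hBS (H := H') (r₀ := r₀) hN0 hNlin hNgrad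
  have hD1 : tD ≤ (1 + N ^ 2) * (2 * Δ) :=
    tayNorm_eval_le_quarter (𝕜 := ℂ) h𝔥 hR hp hBS (H := H - H') (r₀ := r₀) hN0 hNlin hNgrad
  have hN2 : 0 ≤ 1 + N ^ 2 := by positivity
  have hG2 : tG ≤ (1 + N ^ 2) / 8 := by
    have := mul_le_mul_of_nonneg_left (show 2 * hamNorm 𝔥 R B.card H' ≤ 2 * (1 / 16) by linarith) hN2
    linarith
  have hD2 : tD ≤ (1 + N ^ 2) / 4 := by
    have := mul_le_mul_of_nonneg_left (show 2 * Δ ≤ 2 * (1 / 8) by linarith) hN2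
    linarith
  have hq := one_add_sq_le_eight_mul_exp N
  have hexp : Real.exp tG * Real.exp tD ≤ Real.exp (3 / 8) * Real.exp (3 * N ^ 2 / 8) := by
    rw [← Real.exp_add, ← Real.exp_add]
    exact Real.exp_le_exp.2 (by linarith)
  have hsq : Real.exp (N ^ 2 / 8) * Real.exp (3 * N ^ 2 / 8) = Real.exp (N ^ 2 / 2) := by
    rw [← Real.exp_add]; ring_nf
  refine (mul_le_mul h1 h2 (tayNorm_nonneg _ _ _ _) (Real.exp_pos _).le).trans ?_
  calc Real.exp tG * (tD * Real.exp tD) = tD * (Real.exp tG * Real.exp tD) := by ring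
    _ ≤ ((1 + N ^ 2) * (2 * Δ)) * (Real.exp (3 / 8) * Real.exp (3 * N ^ 2 / 8)) :=
        mul_le_mul hD1 hexp (by positivity) (by positivity)
    _ ≤ (8 * Real.exp (N ^ 2 / 8) * (2 * Δ)) * (Real.exp (3 / 8) * Real.exp (3 * N ^ 2 / 8)) := by
        gcongr
    _ = 16 * Real.exp (3 / 8) * Δ * (Real.exp (N ^ 2 / 8) * Real.exp (3 * N ^ 2 / 8)) := by ring
    _ = 16 * Real.exp (3 / 8) * Δ * Real.exp (N ^ 2 / 2) := by rw [hsq]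
    _ ≤ 16 * Real.exp (3 / 8) * Δ * W φ := mul_le_mul_of_nonneg_left hNW (by positivity)

/-- **Lipschitz bound for the Boltzmann factors**: `‖e^{−H(B)} − e^{−H'(B)}‖_{T, W} ≤ 16e^{3/8}‖H − H'‖_{k,0}`
for `‖H‖_{k,0}, ‖H'‖_{k,0} ≤ 1/16`. [cite: AdamsBuchholzKoteckyMuller2019, Lemma 9.3 (9.13)] -/
theorem tayNormLE_cexp_neg_eval_sub {𝔥 R : ℝ} (h𝔥 : 0 < 𝔥) (hR : 0 < R) {p : ℕ}
    (hp : d / 2 + 1 ≤ p) {S B : Finset (Fin d → ZMod M)} (hBS : B ⊆ S)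
    {W : ((Fin d → ZMod M) → ℝ) → ℝ} (hW : Ell2Dominates B 𝔥 R W) {H H' : RelevantHamiltonian ℂ d}
    (r₀ : ℕ) (hH : hamNorm 𝔥 R B.card H ≤ 1 / 16) (hH' : hamNorm 𝔥 R B.card H' ≤ 1 / 16) :
    TayNormLE (fieldGauge 𝔥 R p S) r₀ W
      (fun ψ : (Fin d → ZMod M) → ℝ => Complex.exp (-(eval H B ψ)) - Complex.exp (-(eval H' B ψ)))
      (16 * Real.exp (3 / 8) * hamNorm 𝔥 R B.card (H - H')) := by
  have hfun : (fun ψ : (Fin d → ZMod M) → ℝ => Complex.exp (-(eval H B ψ)) - Complex.exp (-(eval H' B ψ))) =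
      fun ψ => Complex.exp (eval (-H) B ψ) - Complex.exp (eval (-H') B ψ) := by
    funext ψ; rw [eval_neg, eval_neg]
  have hnorm : hamNorm 𝔥 R B.card (-H - -H') = hamNorm 𝔥 R B.card (H - H') := by
    rw [show -H - -H' = -(H - H') by abel, hamNorm_neg]
  rw [hfun, ← hnorm]
  exact tayNormLE_cexp_eval_sub_cexp_eval h𝔥 hR hp hBS hW r₀ (by rwa [hamNorm_neg])
    (by rwa [hamNorm_neg])

/-- **Lipschitz bound of `E` for the torus tower**: on the block `B = B_x` at scale `k ≤ N`, with the
strong weight `W_k^B` of [ABKM19] and `‖H‖_{k,0}, ‖H'‖_{k,0} ≤ 1/16` (at `(𝔥_k, L^k, |B|)`):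
`‖e^{−H(B)} − e^{−H'(B)}‖_{T, W_k^B} ≤ 16e^{3/8}‖H − H'‖_{k,0}`.
[cite: AdamsBuchholzKoteckyMuller2019, Lemma 9.3 (9.13)] -/
theorem tayNormLE_expNegH_sub_strong_abkm {L N Mord R k p : ℕ} {h : ℝ} (hd : 2 ≤ d) (hLodd : Odd L)
    (hM : M = L ^ N) (hk : k ≤ N) (hh : 0 < h) (hMord : d / 2 + 1 ≤ Mord) (hp : d / 2 + 1 ≤ p)
    {x : Fin d → ZMod M} {S : Finset (Fin d → ZMod M)} (hBS : blockOf (L ^ k) x ⊆ S)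
    {H H' : RelevantHamiltonian ℂ d} (r₀ : ℕ)
    (hH : hamNorm (fieldWt h (L : ℝ) d k) ((L : ℝ) ^ k) (blockOf (L ^ k) x).card H ≤ 1 / 16)
    (hH' : hamNorm (fieldWt h (L : ℝ) d k) ((L : ℝ) ^ k) (blockOf (L ^ k) x).card H' ≤ 1 / 16) :
    TayNormLE (fieldGauge (fieldWt h (L : ℝ) d k) ((L : ℝ) ^ k) p S) r₀
      (expWeight (strongCoef h N k • derivForm (L : ℝ) k (diffIndex d Mord)
        (boxDensity (boxRad R L k) (boxWt (L : ℝ) d k) (blockOf (L ^ k) x))))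
      (fun ψ : (Fin d → ZMod M) → ℝ => expNegH H (blockOf (L ^ k) x) ψ - expNegH H' (blockOf (L ^ k) x) ψ)
      (16 * Real.exp (3 / 8) *
        hamNorm (fieldWt h (L : ℝ) d k) ((L : ℝ) ^ k) (blockOf (L ^ k) x).card (H - H')) := by
  have hL0 : (0 : ℝ) < L := by exact_mod_cast hLodd.pos
  exact tayNormLE_cexp_neg_eval_sub (fieldWt_pos hh hL0 d k) (by positivity) hp hBS
    (ell2Dominates_strongWeight_abkm (R := R) hd hLodd hM hk hh hMord x) r₀ hH hH'

end Literature.MathematicalPhysics.StatisticalMechanics.GradientRG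

end
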